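import Mathlib
import Summits.ValiantsHypothesis.ValiantsHypothesis.Theorems.LacunarySymmetroidMatrixDescartesCensusWindowFourWitness

/-!
# `MatrixDescartes` census — WINDOW-4 WITNESS ROWS on a coefficient BOX (certificate format of the W4-tube rows)

HONEST FRAMING.  Object-search cell `pub-symmetroid`, door-A target `DoorA26 := PosRootLawAt 2 6 19`
(stmt-ValiantsHypothesis-19979; OPEN, typed, never asserted).  Companion of `…CensusWindowFourWitness` (two-point witness rows
for «the alternating window 4-nomial `a − b X^u + c X^(u+v) − e X^(u+v+w)` has at most two positive roots»).  With `c, e`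
fixed (the torus gauge of the window) the kill-0 trinomial `T₂` is affine INCREASING in `b` and the kill-`b` twist `Φ` affine
INCREASING in `a`; hence one witness pair, checked at the relevant corners, certifies a whole box `a ∈ [a₁,a₂]`, `b ∈ [b₁,b₂]`
— this is the format in which a numeric W4-tube row («σ_BCD ≤ hi on σ_ABC ∈ [l₁,l₂]», val-sym-door-p1 g9) becomes finitely many
`norm_num` facts about rationals.  Nothing here bounds any census count; `DoorA26` OPEN; nothing on `MatrixDescartes`
(stmt-ValiantsHypothesis-18050) or `VP ≠ VNP`.

[folklore] Monotonicity in one coefficient + the witness rows; elementary.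
-/

-- `Summit.ValiantsHypothesis.ValiantsHypothesis.…` repeats a component by the D-0017 layout
-- (single-conjunct summit), which the `dupNamespace` linter flags; the name is mandated.
set_option linter.dupNamespace false

namespace Summit.ValiantsHypothesis.ValiantsHypothesis.Theorems.LacunarySymmetroidMatrixDescartes.Census

open Polynomial Finset Set
open scoped BigOperators Polynomial

/-- **BOX FORM of the right witness row (kill-`b` form).**  With `c, e` fixed (the torus gauge of the window), `T₂` is affine
increasing in `b` and `Φ` affine increasing in `a`; hence ONE witness pair `r' < r` checked at the corners
(`T₂` at `b = b₂` for the point `r'`, at `b = b₁` for the point `r`, `Φ` at `a = a₂`) certifies the whole box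
`a ∈ [a₁, a₂]`, `b ∈ [b₁, b₂]` (`a₁, b₁ > 0`). [folklore] -/
theorem fourNomial_card_posRoots_le_two_on_box_of_right_witness' {u v w : ℕ} (hu : 0 < u) (hv : 0 < v) (hw : 0 < w)
    {a₁ a₂ b₁ b₂ c e : ℝ} (ha₁ : 0 < a₁) (hb₁ : 0 < b₁) {r' r : ℝ} (hr' : 0 < r') (hrr : r' < r)
    (hT₂r' : (u : ℝ) * b₂ - ((u : ℝ) + v) * c * r' ^ v + ((u : ℝ) + v + w) * e * r' ^ (v + w) < 0)
    (hT₂r : 0 < (u : ℝ) * b₁ - ((u : ℝ) + v) * c * r ^ v + ((u : ℝ) + v + w) * e * r ^ (v + w))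
    (hΦr : (u : ℝ) * a₂ - (v : ℝ) * c * r ^ (u + v) + ((v : ℝ) + w) * e * r ^ (u + v + w) < 0)
    {a b : ℝ} (ha : a₁ ≤ a) (ha' : a ≤ a₂) (hb : b₁ ≤ b) (hb' : b ≤ b₂) :
    ((C a - C b * X ^ u + C c * X ^ (u + v) - C e * X ^ (u + v + w)).roots.toFinset.filter
      (fun x => 0 < x)).card ≤ 2 := by
  have hu' : (0 : ℝ) < u := by exact_mod_cast hu
  have h1 : (u : ℝ) * b ≤ (u : ℝ) * b₂ := mul_le_mul_of_nonneg_left hb' hu'.le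
  have h2 : (u : ℝ) * b₁ ≤ (u : ℝ) * b := mul_le_mul_of_nonneg_left hb hu'.le
  have h3 : (u : ℝ) * a ≤ (u : ℝ) * a₂ := mul_le_mul_of_nonneg_left ha' hu'.le
  exact fourNomial_card_posRoots_le_two_of_right_witness' hu hv hw (ha₁.trans_le ha) (hb₁.trans_le hb) hr' hrr
    (by linarith) (by linarith) (by linarith)

/-- **BOX FORM of the left witness row (kill-`b` form)**: `Φ` at `a = a₂` for the point `r'`, at `a = a₁` for the point
`r`, `T₂` at `b = b₂` for `r`. [folklore] -/
theorem fourNomial_card_posRoots_le_two_on_box_of_left_witness' {u v w : ℕ} (hu : 0 < u) (hv : 0 < v) (hw : 0 < w)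
    {a₁ a₂ b₁ b₂ c e : ℝ} (ha₁ : 0 < a₁) (hb₁ : 0 < b₁) {r r' : ℝ} (hr : 0 < r) (hrr : r < r')
    (hΦr' : (u : ℝ) * a₂ - (v : ℝ) * c * r' ^ (u + v) + ((v : ℝ) + w) * e * r' ^ (u + v + w) < 0)
    (hΦr : 0 < (u : ℝ) * a₁ - (v : ℝ) * c * r ^ (u + v) + ((v : ℝ) + w) * e * r ^ (u + v + w))
    (hT₂r : (u : ℝ) * b₂ - ((u : ℝ) + v) * c * r ^ v + ((u : ℝ) + v + w) * e * r ^ (v + w) < 0)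
    {a b : ℝ} (ha : a₁ ≤ a) (ha' : a ≤ a₂) (hb : b₁ ≤ b) (hb' : b ≤ b₂) :
    ((C a - C b * X ^ u + C c * X ^ (u + v) - C e * X ^ (u + v + w)).roots.toFinset.filter
      (fun x => 0 < x)).card ≤ 2 := by
  have hu' : (0 : ℝ) < u := by exact_mod_cast hu
  have h1 : (u : ℝ) * b ≤ (u : ℝ) * b₂ := mul_le_mul_of_nonneg_left hb' hu'.le
  have h2 : (u : ℝ) * a₁ ≤ (u : ℝ) * a := mul_le_mul_of_nonneg_left ha hu'.le
  have h3 : (u : ℝ) * a ≤ (u : ℝ) * a₂ := mul_le_mul_of_nonneg_left ha' hu'.le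
  exact fourNomial_card_posRoots_le_two_of_left_witness' hu hv hw (ha₁.trans_le ha) (hb₁.trans_le hb) hr hrr
    (by linarith) (by linarith) (by linarith)

end Summit.ValiantsHypothesis.ValiantsHypothesis.Theorems.LacunarySymmetroidMatrixDescartes.Census
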